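import Summits.FinalStateConjecture.FinalStateConjecture.Theorems.EIHFluxBalanceInertialRecessionStubHigherOrderC3StepJets
import Summits.FinalStateConjecture.FinalStateConjecture.Theorems.EIHFluxBalanceInertialRecessionStubHigherOrderApplyCB3

/-!
# Route EIHFluxBalance — `InertialRecession` (E′), line `SketchCleanExcision`, skeleton r13,
# stub `stub_higherOrderSlaving` (EF): the third-order step at one late time

Helper file for the crux `stmt-FinalStateConjecture-17403`
(`Summit.FinalStateConjecture.FinalStateConjecture.Theses.EIHFluxBalance.InertialRecession`, E′),
registered stub `stub_higherOrderSlaving` (orders two and three of frozen-vacuum slaving); the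
lead's stub-offer `higherOrder_c3step_point` (seat 1), the order-three twin of
`higherOrder_rstep_point` (`…StubHigherOrderRStepPoint`).

`higherOrder_c3step_point`: at a late time `t`, the coercivity clause of `stub_coerSymbolQuant`
(hypotheses `hshell`, `hcoer`) applied through `higherOrder_applyCB₃` (`…StubHigherOrderApplyCB3`)
to the re-centred frozen ansatz `w ↦ g₀(w + cᵢ(t))` and the re-centred THIRD variation bounds
`c₀ · red₃ᵢ(t)` (the reduced size of the second skew rate `A″` and third translation `d₃`) by
(a) the modelling error of the third variation (`‖P₃ − W(A″, d₃)‖ ≤ C_J · Werr`, hypothesis `hJ`,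
the order-three clause of `higherOrder_jetBounds`), (b) the derivative of the Ricci form of the
ansatz with the pure cube `⅙(x⁰ − t)³ P₃` removed, compared through its `3`-jet with the frozen own
summand (`higherOrder_norm_fderiv_ricAt_le_of_jets_at`; the jets are within
`C_J (Dsum + 3 SE₁ + 3 S₂)` by the slice model `hslice` = `higherOrder_sliceModel` and the
bookkeeping `higherOrder_c3step_jets`), and (c) the derivative of the Ricci form of the ansatz itself
(hypothesis `hrrc`, the `C³` conjunct of clause (RR) of the crux, at the level
`l = ((R₁ + C_J + 1)³ (1 + S₃))^{1/3}`). The bound is affine in `Werr` and `S₃` with coefficients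
that are small at late times, as the absorption across holes requires.

No definitions, no named facts, no `sorry`.
-/

set_option linter.dupNamespace false
set_option maxSynthPendingDepth 6
set_option synthInstance.maxHeartbeats 200000

noncomputable section

namespace Summit.FinalStateConjecture.FinalStateConjecture.Theorems.SublinearIsFree.Slaving

open scoped Topology ContDiff BigOperators
open Filter Set Function Metric Literature.Geometry.Lorentzian
  Summit.FinalStateConjecture.FinalStateConjecture.Theorems
open MetricCoord

set_option maxHeartbeats 6400000 in
/-- **The third-order step at one late time (pointwise, abstract form).** See the module
docstring: `g₀` is the frozen ansatz, `G₀`, `P₁`, `P₂`, `P₃` its frozen field and variation fields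
at the frozen time `t` (hypothesis `hslice`, the full `3`-jet clause of `higherOrder_sliceModel`),
`Λc`, `ξc` the painted frame and centre of hole `i`, `L` a representative frame at `t` painting the
same radius, `A''`, `d₃` any skew rate and translation; the far holes enter only through the
scalars `Dsum`, `SE₁`, `S₂`, `S₃`, `Werr` of the jet bounds (hypothesis `hJ`, from
`higherOrder_jetBounds`), and `hLip` is a uniform Lipschitz/size bound for `D(ricciJet)` near the
jet box (the shape consumed by `higherOrder_norm_fderiv_ricAt_le_of_jets_at`). [folklore] -/
theorem higherOrder_c3step_point {Mᵢ aᵢ γ : ℝ} (hMi : 0 < Mᵢ) {c₀ ρin ρout η₀ : ℝ}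
    (hshell : ∀ (L : lorentzGroup) (y : E3), |((L : E4 ≃L[ℝ] E4) (E4.basisVector 0)) 0| ≤ γ → ρin ≤ ‖y‖ → 2 * Mᵢ < Kerr.radius aᵢ (poincareInv L 0 (E4.ofTimeSpace 0 y)))
    (hcoer : ∀ (L : lorentzGroup) (A : E4 →L[ℝ] E4) (d : E4) (G G' : E4 → E4 →L[ℝ] E4 →L[ℝ] ℝ) (V : Set E4),
      |((L : E4 ≃L[ℝ] E4) (E4.basisVector 0)) 0| ≤ γ →
      (∀ u w : E4, Minkowski.bilin (A u) w + Minkowski.bilin u (A w) = 0) →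
      MetricCoord.IsMetricOn G V → MetricCoord.IsMetricOn G' V →
      (∀ y : E3, ρin ≤ ‖y‖ → ‖y‖ ≤ ρout → (E4.ofTimeSpace 0 y) ∈ V ∧
        ‖G (E4.ofTimeSpace 0 y) - boostedKerrBilin L 0 Mᵢ aᵢ (E4.ofTimeSpace 0 y)‖ ≤ η₀ ∧
        G' (E4.ofTimeSpace 0 y) = G (E4.ofTimeSpace 0 y) ∧
        fderiv ℝ G' (E4.ofTimeSpace 0 y) = fderiv ℝ G (E4.ofTimeSpace 0 y) ∧
        ∀ v : E4, fderiv ℝ (fderiv ℝ G') (E4.ofTimeSpace 0 y) v =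
          fderiv ℝ (fderiv ℝ G) (E4.ofTimeSpace 0 y) v + (v 0) • (E4.dx 0).smulRight
            ((fderiv ℝ (Kerr.bilin Mᵢ aᵢ) (poincareInv L 0 (E4.ofTimeSpace 0 y)) (A (poincareInv L 0 (E4.ofTimeSpace 0 y)) + d)).bilinearComp (((L : E4 ≃L[ℝ] E4).symm : E4 →L[ℝ] E4)) (((L : E4 ≃L[ℝ] E4).symm : E4 →L[ℝ] E4)) + (Kerr.bilin Mᵢ aᵢ (poincareInv L 0 (E4.ofTimeSpace 0 y))).bilinearComp ((A).comp (((L : E4 ≃L[ℝ] E4).symm : E4 →L[ℝ] E4))) (((L : E4 ≃L[ℝ] E4).symm : E4 →L[ℝ] E4)) + (Kerr.bilin Mᵢ aᵢ (poincareInv L 0 (E4.ofTimeSpace 0 y))).bilinearComp (((L : E4 ≃L[ℝ] E4).symm : E4 →L[ℝ] E4)) ((A).comp (((L : E4 ≃L[ℝ] E4).symm : E4 →L[ℝ] E4))))) →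
      ∃ y : E3, ρin ≤ ‖y‖ ∧ ‖y‖ ≤ ρout ∧
        c₀ * (‖A (E4.basisVector 0)‖ + ‖E4.spatial d‖ + ‖aᵢ • A (E4.basisVector 3)‖) ≤
          ‖MetricCoord.ricAt G' (E4.ofTimeSpace 0 y) - MetricCoord.ricAt G (E4.ofTimeSpace 0 y)‖)
    {g₀ G₀ P₁ P₂ P₃ : E4 → E4 →L[ℝ] E4 →L[ℝ] ℝ} {Us : Set E4} {t : ℝ} (hUso : IsOpen Us)
    (hP₃c : ContDiffOn ℝ ∞ P₃ Us) (hP₃s : ∀ z ∈ Us, ∀ u v : E4, P₃ z u v = P₃ z v u)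
    (hslice : ∀ x ∈ Us, x 0 = t → g₀ x = G₀ x ∧
      (∀ v, fderiv ℝ g₀ x v = fderiv ℝ G₀ x v + (v 0) • P₁ x) ∧
      (∀ v w, fderiv ℝ (fderiv ℝ g₀) x v w = fderiv ℝ (fderiv ℝ G₀) x v w +
        (v 0) • fderiv ℝ P₁ x w + (w 0) • fderiv ℝ P₁ x v + (v 0 * w 0) • P₂ x) ∧
      (∀ y v w, fderiv ℝ (fderiv ℝ (fderiv ℝ g₀)) x y v w = fderiv ℝ (fderiv ℝ (fderiv ℝ G₀)) x y v w +
        ((v 0) • fderiv ℝ (fderiv ℝ P₁) x y w + (w 0) • fderiv ℝ (fderiv ℝ P₁) x y v +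
          (y 0) • fderiv ℝ (fderiv ℝ P₁) x v w) +
        ((v 0 * w 0) • fderiv ℝ P₂ x y + (y 0 * w 0) • fderiv ℝ P₂ x v + (y 0 * v 0) • fderiv ℝ P₂ x w) +
        (y 0 * v 0 * w 0) • P₃ x))
    (Λc : ℝ → lorentzGroup) (ξc : ℝ → E3) (L : lorentzGroup) (hL : |((L : E4 ≃L[ℝ] E4) (E4.basisVector 0)) 0| ≤ γ)
    (hLcol : ∀ x : E4, Kerr.radius aᵢ (poincareInv (Λc t) (E4.ofTimeSpace t (ξc t)) x) =
      Kerr.radius aᵢ (poincareInv L (E4.ofTimeSpace t (ξc t)) x))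
    {A'' : E4 →L[ℝ] E4} (hA''s : ∀ v w : E4, Minkowski.bilin (A'' v) w + Minkowski.bilin v (A'' w) = 0) (d₃ : E4)
    {T₀ m α r₀ : ℝ} (hm : 0 < m) (hr₀M : r₀ < 2 * Mᵢ)
    (hmetric : MetricCoord.IsMetricOn g₀ {z : E4 | T₀ < z 0 ∧ ‖E4.spatial z - ξc (z 0)‖ < (ρout + 1) ∧ r₀ < Kerr.radius aᵢ (poincareInv (Λc (z 0)) (E4.ofTimeSpace (z 0) (ξc (z 0))) z)})
    (hfacts : ∀ z : E4, T₀ < z 0 → ‖E4.spatial z - ξc (z 0)‖ ≤ ρout + 1 →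
      r₀ ≤ Kerr.radius aᵢ (poincareInv (Λc (z 0)) (E4.ofTimeSpace (z 0) (ξc (z 0))) z) →
      (z 0 = t → z ∈ Us) ∧ (∀ v : E4, m * ‖v‖ ≤ ‖g₀ z v‖) ∧ ‖g₀ z‖ ≤ α)
    {C_J Dsum SE₁ S₂ S₃ Werr : ℝ} (hC_J : 0 ≤ C_J) (hDsum : 0 ≤ Dsum) (hSE₁ : 0 ≤ SE₁) (hS₂ : 0 ≤ S₂)
    (hS₃ : 0 ≤ S₃)
    (hJ : ∀ x ∈ Us, x 0 = t → ‖x - E4.ofTimeSpace t (ξc t)‖ ≤ ρout →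
      2 * Mᵢ ≤ Kerr.radius aᵢ (poincareInv L (E4.ofTimeSpace t (ξc t)) x) →
      (‖fderiv ℝ G₀ x‖ ≤ C_J ∧ ‖fderiv ℝ (fderiv ℝ G₀) x‖ ≤ C_J ∧ ‖fderiv ℝ (fderiv ℝ (fderiv ℝ G₀)) x‖ ≤ C_J) ∧
      (‖G₀ x - boostedKerrBilin L (E4.ofTimeSpace t (ξc t)) Mᵢ aᵢ x‖ ≤ C_J * Dsum ∧
        ‖fderiv ℝ G₀ x - fderiv ℝ (boostedKerrBilin L (E4.ofTimeSpace t (ξc t)) Mᵢ aᵢ) x‖ ≤ C_J * Dsum ∧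
        ‖fderiv ℝ (fderiv ℝ G₀) x - fderiv ℝ (fderiv ℝ (boostedKerrBilin L (E4.ofTimeSpace t (ξc t)) Mᵢ aᵢ)) x‖ ≤ C_J * Dsum ∧
        ‖fderiv ℝ (fderiv ℝ (fderiv ℝ G₀)) x - fderiv ℝ (fderiv ℝ (fderiv ℝ (boostedKerrBilin L (E4.ofTimeSpace t (ξc t)) Mᵢ aᵢ))) x‖ ≤ C_J * Dsum) ∧
      (‖P₁ x‖ ≤ C_J * SE₁ ∧ ‖fderiv ℝ P₁ x‖ ≤ C_J * SE₁ ∧ ‖fderiv ℝ (fderiv ℝ P₁) x‖ ≤ C_J * SE₁) ∧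
      (‖P₂ x‖ ≤ C_J * S₂ ∧ ‖fderiv ℝ P₂ x‖ ≤ C_J * S₂) ∧
      (‖P₃ x - ((fderiv ℝ (Kerr.bilin Mᵢ aᵢ) (poincareInv L 0 (x - E4.ofTimeSpace t (ξc t))) (A'' (poincareInv L 0 (x - E4.ofTimeSpace t (ξc t))) + d₃)).bilinearComp (((L : E4 ≃L[ℝ] E4).symm : E4 →L[ℝ] E4)) (((L : E4 ≃L[ℝ] E4).symm : E4 →L[ℝ] E4)) + (Kerr.bilin Mᵢ aᵢ (poincareInv L 0 (x - E4.ofTimeSpace t (ξc t)))).bilinearComp ((A'').comp (((L : E4 ≃L[ℝ] E4).symm : E4 →L[ℝ] E4))) (((L : E4 ≃L[ℝ] E4).symm : E4 →L[ℝ] E4)) + (Kerr.bilin Mᵢ aᵢ (poincareInv L 0 (x - E4.ofTimeSpace t (ξc t)))).bilinearComp (((L : E4 ≃L[ℝ] E4).symm : E4 →L[ℝ] E4)) ((A'').comp (((L : E4 ≃L[ℝ] E4).symm : E4 →L[ℝ] E4))))‖ ≤ C_J * Werr ∧ ‖P₃ x‖ ≤ C_J * S₃))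
    {R₁ : ℝ} (hR₁ : C_J * (1 + 3 * SE₁ + 3 * S₂) + 1 ≤ R₁)
    {r L₁ B₁ : ℝ} (hL₁ : 0 ≤ L₁)
    (hLip : ∀ j' ∈ (Metric.closedBall (0 : E4) ρout ×ˢ ({A : E4 →L[ℝ] E4 →L[ℝ] ℝ | ‖A‖ ≤ α ∧ ∀ v : E4, m * ‖v‖ ≤ ‖A v‖} ×ˢ (Metric.closedBall (0 : E4 →L[ℝ] E4 →L[ℝ] E4 →L[ℝ] ℝ) R₁ ×ˢ Metric.closedBall (0 : E4 →L[ℝ] E4 →L[ℝ] E4 →L[ℝ] E4 →L[ℝ] ℝ) R₁))), ∀ j, ‖j - j'‖ ≤ r →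
      ‖fderiv ℝ (ricciJet (E := E4)) j - fderiv ℝ (ricciJet (E := E4)) j'‖ ≤ L₁ * ‖j - j'‖ ∧
        ‖fderiv ℝ (ricciJet (E := E4)) j‖ ≤ B₁)
    {T₁ ε' : ℝ}
    (hrrc : ∀ x : E4, T₁ < x 0 → ‖E4.spatial x - ξc (x 0)‖ < ρout + 1 →
      r₀ < Kerr.radius aᵢ (poincareInv (Λc (x 0)) (E4.ofTimeSpace (x 0) (ξc (x 0))) x) →
      ∀ l : ℝ, 1 ≤ l → ‖fderiv ℝ g₀ x‖ ≤ l → ‖fderiv ℝ (fderiv ℝ g₀) x‖ ≤ l ^ 2 →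
      ‖fderiv ℝ (fderiv ℝ (fderiv ℝ g₀)) x‖ ≤ l ^ 3 → ‖fderiv ℝ (MetricCoord.ricAt g₀) x‖ ≤ ε' * l ^ 3)
    (ht₀ : T₀ < t) (ht₁ : T₁ < t) (hclose : C_J * Dsum ≤ η₀) (hδr : C_J * (Dsum + 3 * SE₁ + 3 * S₂) ≤ r) :
    c₀ * (‖A'' (E4.basisVector 0)‖ + ‖E4.spatial d₃‖ + ‖aᵢ • A'' (E4.basisVector 3)‖) ≤
      4 * m⁻¹ * C_J * Werr + (L₁ * R₁ + B₁) * (C_J * (Dsum + 3 * SE₁ + 3 * S₂)) +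
        ε' * ((R₁ + C_J + 1) ^ 3 * (1 + S₃)) := by
  -- ### notation
  set c : E4 := E4.ofTimeSpace t (ξc t) with hc
  set K : E4 → E4 →L[ℝ] E4 →L[ℝ] ℝ := boostedKerrBilin L c Mᵢ aᵢ with hK
  -- ### the translated fields
  set V₀ : Set E4 := {z : E4 | T₀ < z 0 ∧ ‖E4.spatial z - ξc (z 0)‖ < (ρout + 1) ∧ r₀ < Kerr.radius aᵢ (poincareInv (Λc (z 0)) (E4.ofTimeSpace (z 0) (ξc (z 0))) z)} ∩ Us with hV₀
  set G : E4 → E4 →L[ℝ] E4 →L[ℝ] ℝ := fun w ↦ g₀ (w + c) with hGdef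
  set P : E4 → E4 →L[ℝ] E4 →L[ℝ] ℝ := fun w ↦ P₃ (w + c) with hPdef
  set V : Set E4 := (fun w ↦ w + c) ⁻¹' V₀ with hV
  have hV₀o : IsOpen V₀ := hmetric.isOpen.inter hUso
  have hg₀V₀ : IsMetricOn g₀ V₀ := KerrSchildChart.isMetricOn_mono hmetric hV₀o inter_subset_left
  have hGfun : (fun w : E4 ↦ g₀ (c + (1 : ℝ) • w)) = G := funext fun w ↦ by rw [one_smul, add_comm]
  have hVset : ((fun w : E4 ↦ c + (1 : ℝ) • w) ⁻¹' V₀) = V := by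
    ext w; simp only [mem_preimage, hV, one_smul, add_comm]
  have hGV : IsMetricOn G V := by
    have hz := isMetricOn_comp_zoom hg₀V₀ c 1
    rw [hGfun, hVset] at hz; exact hz
  have htr : ContDiff ℝ ∞ (fun w : E4 ↦ w + c) := contDiff_id.add contDiff_const
  have hVo : IsOpen V := hV₀o.preimage htr.continuous
  have hPV : ContDiffOn ℝ ∞ P V := hP₃c.comp htr.contDiffOn fun w hw ↦ hw.2
  have hPs : ∀ w ∈ V, ∀ u' v', P w u' v' = P w v' u' := fun w hw u' v' ↦ hP₃s (w + c) hw.2 u' v'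
  -- ### geometry of the shell points
  have hnemb : ∀ v : E3, ‖E4.ofTimeSpace 0 v‖ = ‖v‖ := fun v ↦ by
    rw [norm_eq_spatialNorm_of_apply_zero_eq_zero (E4.ofTimeSpace_apply_zero _ _), E4.spatialNorm,
      E4.spatial_ofTimeSpace]
  have hπ : ∀ v : E4, |v 0| ≤ ‖v‖ := Literature.Geometry.Lorentzian.C0Extension.abs_apply_zero_le_norm
  have hpt : ∀ y : E3, ρin ≤ ‖y‖ → ‖y‖ ≤ ρout →
      (E4.ofTimeSpace 0 y + c) 0 = t ∧
      E4.spatial (E4.ofTimeSpace 0 y + c) - ξc ((E4.ofTimeSpace 0 y + c) 0) = y ∧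
      poincareInv L c (E4.ofTimeSpace 0 y + c) = poincareInv L 0 (E4.ofTimeSpace 0 y) ∧
      2 * Mᵢ < Kerr.radius aᵢ (poincareInv L 0 (E4.ofTimeSpace 0 y)) ∧
      r₀ < Kerr.radius aᵢ (poincareInv (Λc t) c (E4.ofTimeSpace 0 y + c)) ∧
      (E4.ofTimeSpace 0 y + c) ∈ V₀ := by
    intro y hy1 hy2
    have hx0 : (E4.ofTimeSpace 0 y + c) 0 = t := by
      show (E4.ofTimeSpace 0 y) 0 + c 0 = t
      rw [hc, E4.ofTimeSpace_apply_zero, E4.ofTimeSpace_apply_zero, zero_add]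
    have hsp : E4.spatial (E4.ofTimeSpace 0 y + c) - ξc ((E4.ofTimeSpace 0 y + c) 0) = y := by
      rw [hx0, map_add, hc, E4.spatial_ofTimeSpace, E4.spatial_ofTimeSpace, add_sub_cancel_right]
    have hpc : poincareInv L c (E4.ofTimeSpace 0 y + c) = poincareInv L 0 (E4.ofTimeSpace 0 y) := by
      simp only [poincareInv, add_sub_cancel_right, sub_zero]
    have hrad : 2 * Mᵢ < Kerr.radius aᵢ (poincareInv L 0 (E4.ofTimeSpace 0 y)) := hshell L y hL hy1
    have hradt : r₀ < Kerr.radius aᵢ (poincareInv (Λc t) c (E4.ofTimeSpace 0 y + c)) := by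
      rw [hLcol, hpc]; exact hr₀M.trans hrad
    have htube : (E4.ofTimeSpace 0 y + c) ∈ {z : E4 | T₀ < z 0 ∧ ‖E4.spatial z - ξc (z 0)‖ < (ρout + 1) ∧ r₀ < Kerr.radius aᵢ (poincareInv (Λc (z 0)) (E4.ofTimeSpace (z 0) (ξc (z 0))) z)} := by
      refine ⟨by rw [hx0]; exact ht₀, by rw [hsp]; linarith only [hy2], ?_⟩
      rw [hx0]; exact hradt
    have hUsx : (E4.ofTimeSpace 0 y + c) ∈ Us :=
      (hfacts _ (by rw [hx0]; exact ht₀) (by rw [hsp]; linarith only [hy2]) (by rw [hx0]; exact hradt.le)).1 hx0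
    exact ⟨hx0, hsp, hpc, hrad, hradt, ⟨htube, hUsx⟩⟩
  -- ### `boostedKerrBilin L 0 = K (· + c)`
  have hKfun : (fun w : E4 ↦ K (w + c)) = boostedKerrBilin L 0 Mᵢ aᵢ := by
    funext w
    have h1 := higherOrder_boostedKerrBilin_sub_eq_omega L 0 Mᵢ aᵢ w
    have h2 := higherOrder_boostedKerrBilin_sub_eq_omega L c Mᵢ aᵢ (w + c)
    rw [sub_zero] at h1
    rw [add_sub_cancel_right] at h2
    have : K (w + c) - Minkowski.bilin = boostedKerrBilin L 0 Mᵢ aᵢ w - Minkowski.bilin := by rw [hK, h2, h1]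
    exact sub_left_injective this
  -- ### the hypotheses of the coercivity clause along the shell
  have hVs : ∀ y : E3, ρin ≤ ‖y‖ → ‖y‖ ≤ ρout → E4.ofTimeSpace 0 y ∈ V ∧
      ‖G (E4.ofTimeSpace 0 y) - boostedKerrBilin L 0 Mᵢ aᵢ (E4.ofTimeSpace 0 y)‖ ≤ η₀ ∧
      0 < Kerr.radius aᵢ (poincareInv L 0 (E4.ofTimeSpace 0 y)) := by
    intro y hy1 hy2
    obtain ⟨hx0, hsp, hpc, hrad, hradt, hV₀x⟩ := hpt y hy1 hy2
    refine ⟨hV₀x, ?_, (mul_pos two_pos hMi).trans hrad⟩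
    have hKx : boostedKerrBilin L 0 Mᵢ aᵢ (E4.ofTimeSpace 0 y) = K (E4.ofTimeSpace 0 y + c) := by rw [← hKfun]
    obtain ⟨hg0, -, -, -⟩ := hslice _ hV₀x.2 hx0
    have hxc : ‖(E4.ofTimeSpace 0 y + c) - c‖ ≤ ρout := by rw [add_sub_cancel_right, hnemb]; exact hy2
    have h2M : 2 * Mᵢ ≤ Kerr.radius aᵢ (poincareInv L c (E4.ofTimeSpace 0 y + c)) := by rw [hpc]; exact hrad.le
    obtain ⟨-, ⟨hGK0, -, -, -⟩, -, -, -⟩ := hJ _ hV₀x.2 hx0 hxc h2M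
    show ‖g₀ (E4.ofTimeSpace 0 y + c) - boostedKerrBilin L 0 Mᵢ aᵢ (E4.ofTimeSpace 0 y)‖ ≤ η₀
    rw [hKx, hg0]
    exact hGK0.trans hclose
  -- ### apply the coercivity clause, order three
  obtain ⟨y, hy1, hy2, V₁, hyV₁, hV₁V, hGV₁, hG₂V₁, j0, j1, j2, j3, hineq⟩ :=
    higherOrder_applyCB₃ hcoer L hL hA''s d₃ hGV hVs hPV hPs
  obtain ⟨hx0, hsp, hpc, hrad, hradt, hV₀x⟩ := hpt y hy1 hy2
  set xy : E4 := E4.ofTimeSpace 0 y with hxy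
  set x : E4 := xy + c with hx
  set G₂ : E4 → E4 →L[ℝ] E4 →L[ℝ] ℝ := fun w ↦ G w + ((E4.dx 0) w - 0) ^ 3 • ((-(6⁻¹ : ℝ)) • P w) with hG₂
  have hxyn : ‖xy‖ = ‖y‖ := hnemb y
  -- ### the slice model and the jet bounds at `x`
  obtain ⟨hg0, hg1, hg2, hg3⟩ := hslice x hV₀x.2 hx0
  have hxc : ‖x - c‖ ≤ ρout := by rw [hx, add_sub_cancel_right, hxyn]; exact hy2
  have h2M : 2 * Mᵢ ≤ Kerr.radius aᵢ (poincareInv L c x) := by rw [hpc]; exact hrad.le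
  obtain ⟨⟨hB1, hB2, hB3⟩, ⟨hGK0, hGK1, hGK2, hGK3⟩, ⟨hP1a, hP1b, hP1c⟩, ⟨hP2a, hP2b⟩, ⟨hW3, hP3a⟩⟩ :=
    hJ x hV₀x.2 hx0 hxc h2M
  have hxcxy : x - c = xy := by rw [hx, add_sub_cancel_right]
  rw [hxcxy] at hW3
  -- ### the frozen own summand, re-centred at the origin
  obtain ⟨hKm, -, hKDric⟩ := higherOrder_boostedKerr_reference L 0 Mᵢ aᵢ
  have hxyW : xy ∈ {w : E4 | 0 < Kerr.radius aᵢ (poincareInv L 0 w)} := (mul_pos two_pos hMi).trans hrad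
  have hKf1 : fderiv ℝ (fun w : E4 ↦ K (w + c)) = fun w ↦ fderiv ℝ K (w + c) :=
    funext fun w ↦ fderiv_comp_add_right c
  have hKf2 : fderiv ℝ (fun w : E4 ↦ fderiv ℝ K (w + c)) = fun w ↦ fderiv ℝ (fderiv ℝ K) (w + c) :=
    funext fun w ↦ fderiv_comp_add_right c
  have hK0 : boostedKerrBilin L 0 Mᵢ aᵢ xy = K x := by rw [← hKfun]
  have hK1 : fderiv ℝ (boostedKerrBilin L 0 Mᵢ aᵢ) xy = fderiv ℝ K x := by
    rw [← hKfun, fderiv_comp_add_right]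
  have hK2 : fderiv ℝ (fderiv ℝ (boostedKerrBilin L 0 Mᵢ aᵢ)) xy = fderiv ℝ (fderiv ℝ K) x := by
    rw [← hKfun, hKf1, fderiv_comp_add_right]
  have hK3 : fderiv ℝ (fderiv ℝ (fderiv ℝ (boostedKerrBilin L 0 Mᵢ aᵢ))) xy =
      fderiv ℝ (fderiv ℝ (fderiv ℝ K)) x := by
    rw [← hKfun, hKf1, hKf2, fderiv_comp_add_right]
  -- ### the jets of the translated fields at `x_y`
  have hGf1 : fderiv ℝ G = fun w ↦ fderiv ℝ g₀ (w + c) := funext fun w ↦ fderiv_comp_add_right c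
  have hGf2 : fderiv ℝ (fun w : E4 ↦ fderiv ℝ g₀ (w + c)) = fun w ↦ fderiv ℝ (fderiv ℝ g₀) (w + c) :=
    funext fun w ↦ fderiv_comp_add_right c
  have hGxy : G xy = g₀ x := rfl
  have hG1 : fderiv ℝ G xy = fderiv ℝ g₀ x := fderiv_comp_add_right c
  have hG2 : fderiv ℝ (fderiv ℝ G) xy = fderiv ℝ (fderiv ℝ g₀) x := by rw [hGf1, fderiv_comp_add_right]
  have hG3 : fderiv ℝ (fderiv ℝ (fderiv ℝ G)) xy = fderiv ℝ (fderiv ℝ (fderiv ℝ g₀)) x := by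
    rw [hGf1, hGf2, fderiv_comp_add_right]
  have hPxy : P xy = P₃ x := rfl
  have j3' : ∀ u v w : E4, fderiv ℝ (fderiv ℝ (fderiv ℝ G₂)) xy u v w =
      fderiv ℝ (fderiv ℝ (fderiv ℝ g₀)) x u v w - (u 0 * v 0 * w 0) • P₃ x := by
    intro u v w
    rw [hG₂, j3 u, _root_.add_apply, _root_.add_apply, hG3, _root_.smul_apply, _root_.smul_apply,
      ContinuousLinearMap.smulRight_apply, _root_.smul_apply, ContinuousLinearMap.smulRight_apply, hPxy]
    show _ + (u 0) • ((v 0) • ((w 0) • (-P₃ x))) = _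
    rw [smul_neg, smul_neg, smul_neg, smul_smul, smul_smul, ← sub_eq_add_neg]
  -- ### jet bookkeeping
  have hCS : 0 ≤ C_J * SE₁ := mul_nonneg hC_J hSE₁
  have hCS₂ : 0 ≤ C_J * S₂ := mul_nonneg hC_J hS₂
  have hCS₃ : 0 ≤ C_J * S₃ := mul_nonneg hC_J hS₃
  have hCD : 0 ≤ C_J * Dsum := mul_nonneg hC_J hDsum
  obtain ⟨hD1n, hD2n, hD3n, hE3n, hd1', hd2', hd3'⟩ := higherOrder_c3step_jets
    (D₁ := fderiv ℝ g₀ x) (B₁ := fderiv ℝ G₀ x) (K₁ := fderiv ℝ K x) (P₁' := fderiv ℝ P₁ x)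
    (P₂' := fderiv ℝ P₂ x) (D₂ := fderiv ℝ (fderiv ℝ g₀) x) (B₂ := fderiv ℝ (fderiv ℝ G₀) x)
    (K₂ := fderiv ℝ (fderiv ℝ K) x) (P₁'' := fderiv ℝ (fderiv ℝ P₁) x)
    (D₃ := fderiv ℝ (fderiv ℝ (fderiv ℝ g₀)) x) (B₃ := fderiv ℝ (fderiv ℝ (fderiv ℝ G₀)) x)
    (K₃ := fderiv ℝ (fderiv ℝ (fderiv ℝ K)) x) (E₃ := fderiv ℝ (fderiv ℝ (fderiv ℝ G₂)) xy)
    (P₁x := P₁ x) (P₂x := P₂ x) (P₃x := P₃ x)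
    hg1 hg2 hg3 j3' hC_J hCD hCS hCS₂ hCS₃ hB1 hB2 hB3 hGK1 hGK2 hGK3 hP1a hP1b hP1c hP2a hP2b hP3a
  -- ### sizes of the constants
  have hR₁1 : 1 ≤ R₁ := by linarith only [hR₁, hC_J, hCS, hCS₂]
  have hR₁a : C_J + C_J * SE₁ ≤ R₁ := by linarith only [hR₁, hC_J, hCS, hCS₂]
  have hR₁b : C_J + 2 * (C_J * SE₁) + C_J * S₂ ≤ R₁ := by linarith only [hR₁, hC_J, hCS, hCS₂]
  have hR₁c : C_J + 3 * (C_J * SE₁) + 3 * (C_J * S₂) ≤ R₁ := by linarith only [hR₁, hC_J, hCS, hCS₂]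
  set Cl : ℝ := (R₁ + C_J + 1) ^ 3 with hCl
  have hb1 : 1 ≤ R₁ + C_J + 1 := by linarith only [hR₁1, hC_J]
  have hb0 : 0 ≤ R₁ + C_J + 1 := zero_le_one.trans hb1
  have hClb : R₁ + C_J + 1 ≤ Cl := by rw [hCl]; exact le_self_pow₀ hb1 three_ne_zero
  have hCl0 : 0 ≤ Cl := hb0.trans hClb
  have hCl1 : 0 ≤ Cl * (1 + S₃) := mul_nonneg hCl0 (by linarith only [hS₃])
  set l : ℝ := (Cl * (1 + S₃)) ^ (((3 : ℕ) : ℝ)⁻¹) with hl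
  have hl3 : l ^ 3 = Cl * (1 + S₃) := Real.rpow_inv_natCast_pow hCl1 three_ne_zero
  have hlb : R₁ + C_J + 1 ≤ l := by
    rw [hl]
    calc R₁ + C_J + 1 = ((R₁ + C_J + 1) ^ 3) ^ (((3 : ℕ) : ℝ)⁻¹) :=
          (Real.pow_rpow_inv_natCast hb0 three_ne_zero).symm
      _ ≤ (Cl * (1 + S₃)) ^ (((3 : ℕ) : ℝ)⁻¹) := Real.rpow_le_rpow (by positivity) (by
          calc (R₁ + C_J + 1) ^ 3 = Cl * 1 := by rw [hCl, mul_one]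
            _ ≤ Cl * (1 + S₃) := mul_le_mul_of_nonneg_left (by linarith only [hS₃]) hCl0) (by positivity)
  have hl1 : 1 ≤ l := hb1.trans hlb
  have hDl : ‖fderiv ℝ g₀ x‖ ≤ l := hD1n.trans (hR₁a.trans (by linarith only [hlb, hC_J]))
  have hD2l : ‖fderiv ℝ (fderiv ℝ g₀) x‖ ≤ l ^ 2 :=
    hD2n.trans (hR₁b.trans ((by linarith only [hlb, hC_J] : R₁ ≤ l).trans (le_self_pow₀ hl1 two_ne_zero)))
  have hD3l : ‖fderiv ℝ (fderiv ℝ (fderiv ℝ g₀)) x‖ ≤ l ^ 3 := by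
    rw [hl3]
    refine hD3n.trans ?_
    have k1 : C_J + 3 * (C_J * SE₁) + 3 * (C_J * S₂) ≤ Cl := hR₁c.trans (by linarith only [hClb, hC_J])
    have k2 : C_J * S₃ ≤ Cl * S₃ := mul_le_mul_of_nonneg_right (by linarith only [hClb, hR₁1]) hS₃
    linarith only [k1, k2]
  -- ### (RR), third order, at `x`
  have hDric : ‖fderiv ℝ (ricAt g₀) x‖ ≤ ε' * l ^ 3 :=
    hrrc x (by rw [hx0]; exact ht₁) (by rw [hsp]; linarith only [hy2]) (by rw [hx0]; exact hradt) l hl1 hDl hD2l hD3l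
  -- ### the Ricci form of the translated field is that of `g₀`, near `x_y`
  have hRGev : ricAt G =ᶠ[𝓝 xy] fun w ↦ ricAt g₀ (w + c) := by
    filter_upwards [hVo.mem_nhds (show xy ∈ V from hV₀x)] with w hw
    have hmem : c + (1 : ℝ) • w ∈ V₀ := by rw [one_smul, add_comm]; exact hw
    have h := ricAt_comp_zoom_eq hg₀V₀ one_ne_zero (x := c) (z := w) hmem
    rw [hGfun] at h
    rw [h, one_pow, one_smul, one_smul, add_comm]
  have hRG : fderiv ℝ (ricAt G) xy = fderiv ℝ (ricAt g₀) x := by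
    rw [hRGev.fderiv_eq]; exact fderiv_comp_add_right c
  have he₀ : ‖(E4.basisVector 0 : E4)‖ = 1 := Literature.Geometry.Lorentzian.C0Extension.norm_basisVector_zero
  have hRGb : ‖fderiv ℝ (ricAt G) xy (E4.basisVector 0)‖ ≤ ε' * (Cl * (1 + S₃)) := by
    rw [← hl3]
    refine ((fderiv ℝ (ricAt G) xy).le_opNorm _).trans ?_
    rw [he₀, mul_one, hRG]; exact hDric
  -- ### the inverse form and `dx⁰`
  obtain ⟨-, hcoerx, hαx⟩ := hfacts x (by rw [hx0]; exact ht₀) (by rw [hsp]; linarith only [hy2]) (by rw [hx0]; exact hradt.le)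
  have hsharp : ‖sharpAt G xy‖ ≤ m⁻¹ :=
    higherOrder_norm_sharpAt_le hm (hGV.isInvertible xy (hV₁V hyV₁)) fun v ↦ hcoerx v
  have hζ1 : ‖(E4.dx 0 : E4 →L[ℝ] ℝ)‖ ≤ 1 := by
    refine ContinuousLinearMap.opNorm_le_bound _ zero_le_one fun w ↦ ?_
    rw [one_mul, Real.norm_eq_abs]; exact hπ w
  -- ### the jet box
  have hjet1 : ‖fderiv ℝ G₂ xy‖ ≤ R₁ := by rw [j1, hG1]; exact hD1n.trans hR₁a
  have hjet2 : ‖fderiv ℝ (fderiv ℝ G₂) xy‖ ≤ R₁ := by rw [j2, hG2]; exact hD2n.trans hR₁b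
  have hjet3 : ‖fderiv ℝ (fderiv ℝ (fderiv ℝ G₂)) xy‖ ≤ R₁ := hE3n.trans hR₁c
  have hKset : ((xy, G₂ xy, fderiv ℝ G₂ xy, fderiv ℝ (fderiv ℝ G₂) xy)) ∈ (Metric.closedBall (0 : E4) ρout ×ˢ ({A : E4 →L[ℝ] E4 →L[ℝ] ℝ | ‖A‖ ≤ α ∧ ∀ v : E4, m * ‖v‖ ≤ ‖A v‖} ×ˢ (Metric.closedBall (0 : E4 →L[ℝ] E4 →L[ℝ] E4 →L[ℝ] ℝ) R₁ ×ˢ Metric.closedBall (0 : E4 →L[ℝ] E4 →L[ℝ] E4 →L[ℝ] E4 →L[ℝ] ℝ) R₁))) := by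
    refine Set.mk_mem_prod ?_ (Set.mk_mem_prod ?_ (Set.mk_mem_prod ?_ ?_))
    · rw [Metric.mem_closedBall, dist_zero_right, hxyn]; exact hy2
    · rw [j0]; exact ⟨hαx, hcoerx⟩
    · rw [Metric.mem_closedBall, dist_zero_right]; exact hjet1
    · rw [Metric.mem_closedBall, dist_zero_right]; exact hjet2
  -- ### the distance of the jets
  set δ : ℝ := C_J * (Dsum + 3 * SE₁ + 3 * S₂) with hδ
  have hδ0 : 0 ≤ δ := by positivity
  have hd0 : ‖boostedKerrBilin L 0 Mᵢ aᵢ xy - G₂ xy‖ ≤ δ := by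
    rw [j0, hK0, hGxy, hg0, norm_sub_rev]
    refine hGK0.trans ?_
    rw [hδ]; linarith only [hCS, hCS₂]
  have hd1 : ‖fderiv ℝ (boostedKerrBilin L 0 Mᵢ aᵢ) xy - fderiv ℝ G₂ xy‖ ≤ δ := by
    rw [j1, hK1, hG1]
    refine hd1'.trans ?_
    rw [hδ]; linarith only [hCS, hCS₂]
  have hd2 : ‖fderiv ℝ (fderiv ℝ (boostedKerrBilin L 0 Mᵢ aᵢ)) xy - fderiv ℝ (fderiv ℝ G₂) xy‖ ≤ δ := by
    rw [j2, hK2, hG2]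
    refine hd2'.trans ?_
    rw [hδ]; linarith only [hCS, hCS₂]
  have hd3 : ‖fderiv ℝ (fderiv ℝ (fderiv ℝ (boostedKerrBilin L 0 Mᵢ aᵢ))) xy -
      fderiv ℝ (fderiv ℝ (fderiv ℝ G₂)) xy‖ ≤ δ := by
    rw [hK3]
    refine hd3'.trans ?_
    rw [hδ]; linarith only [hCS, hCS₂]
  have hRic₂ : ‖fderiv ℝ (ricAt G₂) xy‖ ≤ (L₁ * R₁ + B₁) * δ :=
    higherOrder_norm_fderiv_ricAt_le_of_jets_at (G := boostedKerrBilin L 0 Mᵢ aᵢ) (G' := G₂)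
      (W := {w : E4 | 0 < Kerr.radius aᵢ (poincareInv L 0 w)}) (W' := V₁) (x := xy)
      (K := (Metric.closedBall (0 : E4) ρout ×ˢ ({A : E4 →L[ℝ] E4 →L[ℝ] ℝ | ‖A‖ ≤ α ∧ ∀ v : E4, m * ‖v‖ ≤ ‖A v‖} ×ˢ (Metric.closedBall (0 : E4 →L[ℝ] E4 →L[ℝ] E4 →L[ℝ] ℝ) R₁ ×ˢ Metric.closedBall (0 : E4 →L[ℝ] E4 →L[ℝ] E4 →L[ℝ] E4 →L[ℝ] ℝ) R₁))))
      (r := r) (L₁ := L₁) (B₁ := B₁) (δ := δ) (Γ := R₁)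
      hKm hG₂V₁ hxyW hyV₁ (hKDric xy hxyW) hL₁ hR₁1 hLip hKset hδ0 hδr hd0 hd1 hd2 hd3 hjet1 hjet2 hjet3
  have hRic₂b : ‖fderiv ℝ (ricAt G₂) xy (E4.basisVector 0)‖ ≤ (L₁ * R₁ + B₁) * δ := by
    refine ((fderiv ℝ (ricAt G₂) xy).le_opNorm _).trans ?_
    rw [he₀, mul_one]; exact hRic₂
  -- ### the modelling error
  have hWP : ‖((fderiv ℝ (Kerr.bilin Mᵢ aᵢ) (poincareInv L 0 xy) (A'' (poincareInv L 0 xy) + d₃)).bilinearComp (((L : E4 ≃L[ℝ] E4).symm : E4 →L[ℝ] E4)) (((L : E4 ≃L[ℝ] E4).symm : E4 →L[ℝ] E4)) + (Kerr.bilin Mᵢ aᵢ (poincareInv L 0 xy)).bilinearComp ((A'').comp (((L : E4 ≃L[ℝ] E4).symm : E4 →L[ℝ] E4))) (((L : E4 ≃L[ℝ] E4).symm : E4 →L[ℝ] E4)) + (Kerr.bilin Mᵢ aᵢ (poincareInv L 0 xy)).bilinearComp (((L : E4 ≃L[ℝ] E4).symm : E4 →L[ℝ] E4)) ((A'').comp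 (((L : E4 ≃L[ℝ] E4).symm : E4 →L[ℝ] E4)))) - P xy‖ ≤ C_J * Werr := by rw [norm_sub_rev, hPxy]; exact hW3
  -- ### conclusion
  have hfirst : 4 * ‖sharpAt G xy‖ * ‖(E4.dx 0 : E4 →L[ℝ] ℝ)‖ ^ 2 * ‖((fderiv ℝ (Kerr.bilin Mᵢ aᵢ) (poincareInv L 0 xy) (A'' (poincareInv L 0 xy) + d₃)).bilinearComp (((L : E4 ≃L[ℝ] E4).symm : E4 →L[ℝ] E4)) (((L : E4 ≃L[ℝ] E4).symm : E4 →L[ℝ] E4)) + (Kerr.bilin Mᵢ aᵢ (poincareInv L 0 xy)).bilinearComp ((A'').comp (((L : E4 ≃L[ℝ] E4).symm : E4 →L[ℝ] E4))) (((L : E4 ≃L[ℝ] E4).symm : E4 →L[ℝ] E4)) + (Kerr.bilin Mᵢ aᵢ (poincareInv L 0 xy)).bilinearComp (((L : E4 ≃L[ℝ] E4).symm : E4 →L[ℝ] E4)) ((A'').comp (((L : E4 ≃L[ℝ] E4).symm : E4 →L[ℝ] E4)))) - P xy‖ ≤ 4 * m⁻¹ * C_J * Werr := by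
    have hζ2 : ‖(E4.dx 0 : E4 →L[ℝ] ℝ)‖ ^ 2 ≤ 1 := by nlinarith only [hζ1, norm_nonneg (E4.dx 0 : E4 →L[ℝ] ℝ)]
    calc 4 * ‖sharpAt G xy‖ * ‖(E4.dx 0 : E4 →L[ℝ] ℝ)‖ ^ 2 * ‖((fderiv ℝ (Kerr.bilin Mᵢ aᵢ) (poincareInv L 0 xy) (A'' (poincareInv L 0 xy) + d₃)).bilinearComp (((L : E4 ≃L[ℝ] E4).symm : E4 →L[ℝ] E4)) (((L : E4 ≃L[ℝ] E4).symm : E4 →L[ℝ] E4)) + (Kerr.bilin Mᵢ aᵢ (poincareInv L 0 xy)).bilinearComp ((A'').comp (((L : E4 ≃L[ℝ] E4).symm : E4 →L[ℝ] E4))) (((L : E4 ≃L[ℝ] E4).symm : E4 →L[ℝ] E4)) + (Kerr.bilin Mᵢ aᵢ (poincareInv L 0 xy)).bilinearComp (((L : E4 ≃L[ℝ] E4).symm : E4 →L[ℝ] E4)) ((A'').comp (((L : E4 ≃L[ℝ] E4).symm : E4 →L[ℝ] E4)))) - P xy‖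
        ≤ 4 * m⁻¹ * 1 * (C_J * Werr) := by gcongr
      _ = _ := by ring
  linarith only [hineq, hfirst, hRic₂b, hRGb]

/-- **Registered one-line carrier form** (`higherOrder_c3step_EF`): the cube-root level is a
cube root (`Real.rpow_inv_natCast_pow`). [folklore] -/
theorem higherOrder_c3step_EF : ∀ (X : ℝ), 0 ≤ X → (X ^ (((3 : ℕ) : ℝ)⁻¹)) ^ 3 = X :=
  fun _ hX ↦ Real.rpow_inv_natCast_pow hX three_ne_zero

end Summit.FinalStateConjecture.FinalStateConjecture.Theorems.SublinearIsFree.Slaving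

end
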